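import Summits.BirchSwinnertonDyer.BirchSwinnertonDyer.Theorems.KatoDescentPotSupersingularKatoSelmerSharpBound
import Summits.BirchSwinnertonDyer.BirchSwinnertonDyer.Theorems.RamifiedSevenEllipticUnitsStrictControlStrictTower
import Summits.BirchSwinnertonDyer.Rank1Residual.Additive.KatoDescentStrictSelmerLevel
import Summits.BirchSwinnertonDyer.Rank1Residual.X11b.KummerRelaxedStructures
import Summits.BirchSwinnertonDyer.Rank1Residual.X11b.PrimaryInclusionLevels
import Literature.NumberTheory.EllipticCurves.LocalEulerCharacteristicTorsion
import Literature.NumberTheory.EllipticCurves.SelmerLevelToPrimary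
import Mathlib.NumberTheory.Padics.HeightOneSpectrum
import HarnessLib

/-!
# HT-C4 (a)(b): level passage `W[p^J]` ↔ `W[p^∞]` — the finite-level Kummer structures made strict / relaxed at the
# place above `p` count the `p^J`-torsion of the strict / relaxed `p^∞`-Selmer groups

Seat `bsd-2adic-t42` GEN 40 (hand h6 = HT-C4 of LEAD ss-1 GEN 21, `HAND-TARGETS-CDC-2.md` §2, scratch
`HANDTARGETS_CDC2_GEN21.lean` :64 / :77; crux 19097 `SupersingularRankZeroAtTwo`, line `odd_blind_package`, slot 5 CDC_H —
`--supports stmt-BirchSwinnertonDyer-19097 --as helper`). THEOREMS ONLY (no definition, no named fact, no `sorry`).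
`c`-generic, `W`-generic, `p`-generic. Companion of `…FlatBlindLevelRaise` (part (c), p814002).

## What

`ι_J = H¹(W[p^J] ↪ W[p^∞]) : H¹(ℚ, W[p^J]) → H¹(ℚ, W[p^∞])` (the tree's `torsionPowToPrimaryH1 W p J`, definitionally X11b's
`galoisCohomology.map (Levels.primaryInclusion W p J) 1`) is injective as soon as `W[p^∞]^{Γ_ℚ} = 0`
(`torsionPowToPrimaryH1_injective`), has image the `p^J`-torsion (X11b `Levels.mem_range_map_primaryInclusion_iff`), and carries the local
Kummer condition at every place `v` (finite or infinite) onto the classical `p^∞` condition `selmerLocalKerPrimary W ℚ_v p`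
(`KatoFiniteLevelCount.localization_mem_kummerSelmerStructure_iff_map_primaryInclusion_mem`). Hence:

* §1 `geomPrimaryTorsion_eq_zero_of_fixed_adicCompletion` — **no `p`-torsion in `W(K_v)` ⟹ `W[p^∞]^{Γ_{K_v}} = 0`**
  (a fixed `p^m`-torsion point is an invariant of `W[p^m]|_{Γ_{K_v}}`, a group of order `#W(K_v)[p^m] = 1`, tree
  `natCard_invariants_torsion_restrictField`); so `ι_J` is injective over `ℚ` AND over `ℚ_{v₀}`
  (X11b `map_primaryInclusion_injective`, `map_primaryInclusion_restrictField_injective`).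
* §2 `natCard_eq_natCard_torsionBy_of_iff` — the counting frame: if `ι_J` is injective and a level-`J` subgroup `L` is the
  exact preimage of `S ≤ H¹(ℚ, W[p^∞])`, then `#L = #S[p^J]` (bijection `c ↦ ι_J c`, onto by the range computation).
* §3 `selmerLocalKerPrimaryTorsion_padic_eq` — the strict local condition at `p` computed with Mathlib's `ℚ_[p]` IS the one at
  the completion `ℚ_{v_p}` (`Padic.adicCompletionEquiv`, both directions of `RamifiedSevenEllipticUnits.selmerLocalKerPrimaryTorsion_le_of_tower`),
  and at `ℚ_{v_p}` it reads `loc_{v_p} = 0` (`StrictCount.mem_selmerLocalKerPrimaryTorsion_adicCompletion_iff_localization_eq_zero`).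
* §4 ★ `HTC4_natCard_selmerGroup_kummerStrict_eq` (hand (a), VERBATIM) — `#H¹_{kummerStrict {v₀}}(ℚ, W[p^J]) =
  #(Sel_{p^∞} ⊓ strict@ℚ_p)[p^J]`: at `v ≠ v₀` Kummer ↔ `selmerLocalKerPrimary`; at `v₀`, `loc_{v₀} c = 0 ⟺ loc_{v₀} ι_J c = 0`
  (`res ∘ H¹(ι) = H¹(ι|) ∘ res` and §1's local injectivity) `⟺ ι_J c` strict at `ℚ_{v₀} = ℚ_p` (§3).
* §5 ★ `HTC4_natCard_selmerGroup_kummerRelaxed_eq` (hand (b), VERBATIM) — the same with `⊤` at `v₀` on both sides, under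
  `W(ℚ)[p] = 0` only.

HONEST FRAMING: finite-level ↔ `p^∞` bookkeeping (Greenberg LNM 1716 §2); nothing about any summit is asserted; closes no item;
19097 stays OPEN; BSD is proved for no curve by any of this; typed ≠ proved.

References: [GreenbergLNM1716] §2 pp. 62–63, §5 proof of Prop. 5.8; [MilneADT2006] I §3 Lemma 3.3, I §6 (6.5), Lemma 6.15;
[SilvermanAEC2009] VIII §2, X.§4 diagram (**); [SerreGaloisCohomology1997] I §2.4, II §1.1.
-/

set_option autoImplicit false
set_option linter.dupNamespace false -- the summit and its single problem are both `BirchSwinnertonDyer` (D-0017 layout)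

noncomputable section

open scoped Classical NumberField AddSubgroup

namespace Summit.BirchSwinnertonDyer.BirchSwinnertonDyer.Theorems.FlatBlindLevelPassage

open NumberField IsDedekindDomain Field WeierstrassCurve Literature.NumberTheory.EllipticCurves
  Literature.NumberTheory.GaloisRepresentations
open Literature.NumberTheory.GaloisRepresentations.DiscreteGaloisModule (SelmerStructure)
open Summit.BirchSwinnertonDyer.Rank1Residual.X11b Summit.BirchSwinnertonDyer.Rank1Residual.X11b.Levels
  Summit.BirchSwinnertonDyer.Rank1Residual.X11b.LocBridge
open Summit.BirchSwinnertonDyer.BirchSwinnertonDyer.Theorems.KatoFiniteLevelCount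
  (localization_mem_kummerSelmerStructure_iff_map_primaryInclusion_mem eq_primePlace_of_natCast_mem)
open Summit.BirchSwinnertonDyer.Rank1Residual.Additive.StrictCount
  (mem_selmerLocalKerPrimaryTorsion_adicCompletion_iff_localization_eq_zero)
open Summit.BirchSwinnertonDyer.BirchSwinnertonDyer.Theorems.RamifiedSevenEllipticUnits
  (selmerLocalKerPrimaryTorsion_le_of_tower)
open Literature.NumberTheory.EllipticCurves.Kato2004 (primePlace)

universe u

/-! ## §1 No `p`-torsion in `W(K_v)` ⟹ no `Γ_{K_v}`-fixed point in `W[p^∞]` -/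

section Fixed

/-- If an abelian group has no `ℓ`-torsion it has no `ℓ^k`-torsion. [folklore] -/
theorem eq_zero_of_pow_smul_eq_zero {A : Type*} [AddCommGroup A] {ℓ : ℕ} (h : ∀ a : A, ℓ • a = 0 → a = 0)
    (k : ℕ) (a : A) (ha : ℓ ^ k • a = 0) : a = 0 := by
  induction k generalizing a with
  | zero => simpa using ha
  | succ k ih =>
    rw [pow_succ, mul_smul] at ha
    exact h a (ih (ℓ • a) ha)

variable {K : Type} [Field K] [NumberField K] (W : WeierstrassCurve K) [W.IsElliptic] (p : ℕ) [hp : Fact p.Prime]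
  (v : HeightOneSpectrum (𝓞 K))

/-- **`W(K_v)[p] = 0 ⟹ W(K̄)[p^∞]^{Γ_{K_v}} = 0`**: a `Γ_{K_v}`-fixed point `Q ∈ W[p^∞]` killed by `p^m` is an invariant of the
restricted module `W[p^m]|_{Γ_{K_v}}`, whose invariants have order `#W(K_v)[p^m]` (Milne I §3 `H⁰(K, A_n) = A(K)_n`, tree
`natCard_invariants_torsion_restrictField`) `= 1` (no `p`-torsion ⟹ no `p^m`-torsion). Greenberg's standing hypothesis
"`E(F_v)[p] = 0`" read on the Galois module. [cite: GreenbergLNM1716, §2 p. 63] [cite: MilneADT2006, I Lemma 3.3] -/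
theorem geomPrimaryTorsion_eq_zero_of_fixed_adicCompletion
    (h0 : ∀ P : (W.baseChange (v.adicCompletion K)).toAffine.Point, p • P = 0 → P = 0)
    (Q : W.geomPrimaryTorsion p)
    (hQ : ∀ σ : absoluteGaloisGroup (v.adicCompletion K),
      GaloisRep.restrictField (v.adicCompletion K) (LocBridge.primaryGaloisModule W p) σ Q = Q) :
    Q = 0 := by
  let F : Type := v.adicCompletion K
  haveI : CharZero F := charZero_adicCompletion v
  obtain ⟨m, hm⟩ := (AddCommGroup.mem_primaryComponent).1 Q.2
  have hn0 : (p ^ m : ℕ) ≠ 0 := pow_ne_zero m hp.out.ne_zero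
  -- `Q` as an invariant of `W[p^m]|_{Γ_{K_v}}`
  let T : W.geomTorsion ((p ^ m : ℕ) : ℤ) := ⟨(Q : W.geomPoints), (W.mem_geomTorsion_iff _ _).2 (by
    rw [natCast_zsmul]; exact hm)⟩
  set V := (GaloisRep.restrictField F (W.torsionGaloisModule ((p ^ m : ℕ) : ℤ))).toTopRep.ρ.invariants with hV
  have hT : T ∈ V := by
    rw [hV]
    refine (Representation.mem_invariants _ _).2 fun σ ↦ ?_
    apply Subtype.ext
    have h := congrArg (fun Q : W.geomPrimaryTorsion p ↦ (Q : W.geomPoints)) (hQ σ)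
    simp only [GaloisRep.restrictField_apply, LocBridge.primaryGaloisModule, LocBridge.ofSMul_apply_apply,
      primaryComponent.coe_smul] at h
    change (((absGaloisRestrict K F σ) • T : W.geomTorsion ((p ^ m : ℕ) : ℤ)) : W.geomPoints) = (T : W.geomPoints)
    rw [AddSubgroup.torsionBy.coe_smul]
    exact h
  -- `#V = #W(K_v)[p^m] = 1`
  have hker : (nsmulAddMonoidHom (p ^ m) : (W.baseChange F).toAffine.Point →+ _).ker = ⊥ := by
    rw [eq_bot_iff]
    intro P hP
    exact (AddSubgroup.mem_bot).2 (eq_zero_of_pow_smul_eq_zero h0 m P (by simpa using hP))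
  have hcard : Nat.card V = 1 := by
    rw [hV, natCard_invariants_torsion_restrictField W F hn0, hker]
    exact AddSubgroup.card_bot
  haveI : Subsingleton V := (Nat.card_eq_one_iff_unique.mp hcard).1
  have hT0 : (⟨T, hT⟩ : V) = 0 := Subsingleton.elim _ _
  apply Subtype.ext
  rw [ZeroMemClass.coe_zero]
  refine (congrArg (fun x : V ↦ (((x : W.geomTorsion ((p ^ m : ℕ) : ℤ)) : W.geomPoints))) hT0).trans ?_
  simp

omit [NumberField K] [W.IsElliptic] hp in
/-- **`W(K)[p] = 0 ⟹ ι_M : H¹(K, W[p^M]) → H¹(K, W[p^∞])` is injective** (the tree's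
`torsionPowToPrimaryH1_injective_of_torsionBy_eq_bot`, with the hypothesis in the pointwise form `∀ P, p • P = 0 → P = 0`;
stated for a general perfect field so that the group law on `W(K)` is elaborated once, classically).
[cite: GreenbergLNM1716, §2 p. 63] -/
theorem torsionPowToPrimaryH1_injective_of_forall [PerfectField K] (M : ℕ)
    (hK : ∀ P : W.toAffine.Point, p • P = 0 → P = 0) : Function.Injective (W.torsionPowToPrimaryH1 p M) :=
  W.torsionPowToPrimaryH1_injective_of_torsionBy_eq_bot p M (by
    rw [eq_bot_iff]
    intro P hP
    exact (AddSubgroup.mem_bot).2 (hK P ((AddSubgroup.torsionBy.nsmul_iff).1 hP)))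

end Fixed

/-! ## §2 The counting frame: `#L = #S[p^J]` along an injective `ι_J` with `L = ι_J⁻¹ S` -/

section Count

variable {K : Type u} [Field K] (W : WeierstrassCurve K) [W.IsElliptic] (p k : ℕ) [hp : Fact p.Prime]

/-- **`#L = #S[p^k]`** for a subgroup `L ≤ H¹(K, W[p^k])` which is the exact preimage under
`ι_k = torsionPowToPrimaryH1 W p k : H¹(K, W[p^k]) → H¹(K, W[p^∞])` of a subgroup `S ≤ H¹(K, W[p^∞])`, when `ι_k` is
injective: `c ↦ ι_k c` is a bijection `L → S[p^k]` (into the `p^k`-torsion by `pow_nsmul_torsionPowToPrimaryH1`; onto because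
the image of `ι_k` is the whole `p^k`-torsion, X11b `Levels.mem_range_map_primaryInclusion_iff`, from
`0 → W[p^k] → W[p^∞] → W[p^∞] → 0`). [cite: GreenbergLNM1716, §2 p. 63 and §5 proof of Prop. 5.8] -/
theorem natCard_eq_natCard_torsionBy_of_iff
    (L : AddSubgroup (galoisCohomology (W.torsionGaloisModule ((p ^ k : ℕ) : ℤ)) 1))
    (S : AddSubgroup (W.galH1Primary p))
    (hinj : Function.Injective (W.torsionPowToPrimaryH1 p k))
    (hiff : ∀ c, c ∈ L ↔ W.torsionPowToPrimaryH1 p k c ∈ S) :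
    Nat.card L = Nat.card ((↥S)[((p ^ k : ℕ) : ℤ)]) := by
  have hdiv : W.zsmul_geomPoints_surjective := W.zsmul_geomPoints_surjective_holds
  -- the map `c ↦ ι_k c` lands in the `p^k`-torsion
  have htor : ∀ c : L, (⟨W.torsionPowToPrimaryH1 p k c.1, (hiff c.1).1 c.2⟩ : S) ∈ (↥S)[((p ^ k : ℕ) : ℤ)] :=
      fun c ↦ by
    refine (AddSubgroup.torsionBy.nsmul_iff).2 (Subtype.ext ?_)
    rw [AddSubmonoidClass.coe_nsmul, ZeroMemClass.coe_zero]
    exact W.pow_nsmul_torsionPowToPrimaryH1 p k c.1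
  refine Nat.card_congr (Equiv.ofBijective (fun c ↦ ⟨_, htor c⟩) ⟨fun c₁ c₂ h ↦ ?_, fun y ↦ ?_⟩)
  · exact Subtype.ext (hinj (congrArg (fun z : (↥S)[((p ^ k : ℕ) : ℤ)] ↦ ((z : S) : W.galH1Primary p)) h))
  · have hy : p ^ k • (((y : S) : W.galH1Primary p)) = 0 := by
      have h := congrArg (fun z : S ↦ (z : W.galH1Primary p)) ((AddSubgroup.torsionBy.nsmul_iff).1 y.2)
      simpa only [AddSubmonoidClass.coe_nsmul, ZeroMemClass.coe_zero] using h
    -- the image of `ι_k` (definitionally X11b's `H¹(primaryInclusion)`) is the `p^k`-torsion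
    obtain ⟨c, hc⟩ := (mem_range_map_primaryInclusion_iff W p k hdiv _).2 hy
    have hc' : W.torsionPowToPrimaryH1 p k c = ((y : S) : W.galH1Primary p) := hc
    have hcL : c ∈ L := (hiff c).2 (by rw [hc']; exact (y : S).2)
    exact ⟨⟨c, hcL⟩, Subtype.ext (Subtype.ext hc')⟩

end Count

/-! ## §3 The strict condition at `p`: Mathlib's `ℚ_[p]` vs the completion `ℚ_{v_p}`, and `loc_{v_p} = 0` -/

section Padic

variable (W : WeierstrassCurve ℚ) (p : ℕ) [Fact p.Prime]

/-- **The strict local condition at `p` does not depend on the model of `ℚ_p`**: computed with Mathlib's `ℚ_[p]` it equals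
the one at the completion `ℚ_{v_p}` (`v_p = primePlace p`), both inclusions being
`selmerLocalKerPrimaryTorsion_le_of_tower` along `Padic.adicCompletionEquiv : ℚ_[p] ≃A[ℚ] ℚ_{v_p}` and its inverse.
[cite: SerreGaloisCohomology1997, I.§2.4 and II.§1.1] -/
theorem selmerLocalKerPrimaryTorsion_padic_eq :
    selmerLocalKerPrimaryTorsion W ℚ_[p] p = selmerLocalKerPrimaryTorsion W ((primePlace p).adicCompletion ℚ) p := by
  let e : ℚ_[p] ≃A[ℚ] (primePlace p).adicCompletion ℚ := Padic.adicCompletionEquiv (𝓞 ℚ) ⟨p, Fact.out⟩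
  apply le_antisymm
  · letI : Algebra ℚ_[p] ((primePlace p).adicCompletion ℚ) := e.toAlgEquiv.toAlgHom.toRingHom.toAlgebra
    haveI : IsScalarTower ℚ ℚ_[p] ((primePlace p).adicCompletion ℚ) :=
      IsScalarTower.of_algebraMap_eq fun q ↦ (e.toAlgEquiv.toAlgHom.commutes q).symm
    exact selmerLocalKerPrimaryTorsion_le_of_tower W p
  · letI : Algebra ((primePlace p).adicCompletion ℚ) ℚ_[p] := e.toAlgEquiv.symm.toAlgHom.toRingHom.toAlgebra
    haveI : IsScalarTower ℚ ((primePlace p).adicCompletion ℚ) ℚ_[p] :=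
      IsScalarTower.of_algebraMap_eq fun q ↦ (e.toAlgEquiv.symm.toAlgHom.commutes q).symm
    exact selmerLocalKerPrimaryTorsion_le_of_tower W p

variable [W.IsElliptic]

/-- **`ι_J c` is strict at `ℚ_p` iff `H¹(ι|_{Γ_{v_p}})(loc_{v_p} c) = 0`** (§3's transport, the strict condition read as
`loc_{v_p} = 0`, and `res ∘ H¹(ι) = H¹(ι|) ∘ res`; `torsionPowToPrimaryH1 = H¹(primaryInclusion)` definitionally).
[cite: GreenbergLNM1716, §2 p. 63] [cite: SerreGaloisCohomology1997, I.§2.4] -/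
theorem torsionPowToPrimaryH1_mem_selmerLocalKerPrimaryTorsion_padic_iff (J : ℕ)
    (c : galoisCohomology (W.torsionGaloisModule ((p ^ J : ℕ) : ℤ)) 1) :
    W.torsionPowToPrimaryH1 p J c ∈ selmerLocalKerPrimaryTorsion W ℚ_[p] p ↔
      galoisCohomology.map ((primaryInclusion W p J).restrictField ((primePlace p).adicCompletion ℚ)) 1
        (galoisCohomology.localization (W.torsionGaloisModule ((p ^ J : ℕ) : ℤ)) (Sum.inr (primePlace p)) 1 c) = 0 := by
  rw [selmerLocalKerPrimaryTorsion_padic_eq, mem_selmerLocalKerPrimaryTorsion_adicCompletion_iff_localization_eq_zero]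
  change galoisCohomology.res _ _ 1 (galoisCohomology.map (primaryInclusion W p J) 1 c) = 0 ↔ _
  rw [galoisCohomology.res_map_one]
  rfl

end Padic

/-! ## §4 ★ HT-C4 (a): the Kummer structure made STRICT at `v₀ ∣ p` -/

section Hands

/-- The three local readings of a level-`J` class `c` through `ι_J` over `ℚ`: at a finite place / at an infinite place the
Kummer condition is `ι_J c ∈ selmerLocalKerPrimary` (`KatoFiniteLevelCount.localization_mem_kummerSelmerStructure_iff_…`,
restated with `Place.Completion` unfolded and `ι_J = torsionPowToPrimaryH1`). [cite: SilvermanAEC2009, X.§4 diagram (**)] -/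
theorem localization_inr_mem_kummerSelmerStructure_iff (W : WeierstrassCurve ℚ) (p J : ℕ)
    (v : HeightOneSpectrum (𝓞 ℚ)) (c : galoisCohomology (W.torsionGaloisModule ((p ^ J : ℕ) : ℤ)) 1) :
    galoisCohomology.localization (W.torsionGaloisModule ((p ^ J : ℕ) : ℤ)) (Sum.inr v) 1 c ∈
        W.kummerSelmerStructure ((p ^ J : ℕ) : ℤ) (Sum.inr v) ↔
      W.torsionPowToPrimaryH1 p J c ∈ W.selmerLocalKerPrimary (v.adicCompletion ℚ) p :=
  localization_mem_kummerSelmerStructure_iff_map_primaryInclusion_mem W p J (Sum.inr v) c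

/-- Infinite-place twin of `localization_inr_mem_kummerSelmerStructure_iff`. [cite: SilvermanAEC2009, X.§4 diagram (**)] -/
theorem localization_inl_mem_kummerSelmerStructure_iff (W : WeierstrassCurve ℚ) (p J : ℕ)
    (w : InfinitePlace ℚ) (c : galoisCohomology (W.torsionGaloisModule ((p ^ J : ℕ) : ℤ)) 1) :
    galoisCohomology.localization (W.torsionGaloisModule ((p ^ J : ℕ) : ℤ)) (Sum.inl w) 1 c ∈
        W.kummerSelmerStructure ((p ^ J : ℕ) : ℤ) (Sum.inl w) ↔
      W.torsionPowToPrimaryH1 p J c ∈ W.selmerLocalKerPrimary w.Completion p :=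
  localization_mem_kummerSelmerStructure_iff_map_primaryInclusion_mem W p J (Sum.inl w) c

/-- **HT-C4(a) = h6, part (a) (LEVEL PASSAGE, STRICT at `p`) — hand of LEAD ss-1 GEN 21, signature verbatim.** For an
elliptic curve `W/ℚ`, a prime `p`, the place `v₀ ∋ p`, NO `p`-torsion in `W(ℚ_{v₀})` (hence none in `W(ℚ)`), and any level
`J`: the level-`ℚ` Selmer group of `W[p^J]` for the Kummer structure made STRICT (`⊥`) at `v₀`
(`KummerPT.kummerStrict W (p^J) {v₀}`: Kummer `im κ_v` at every other place, finite or infinite) has exactly as many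
elements as the `p^J`-torsion of the `p`-STRICT `p^∞`-Selmer group
`Sel_{p^∞}(W/ℚ) ∩ ker(H¹(ℚ, W[p^∞]) → H¹(ℚ_p, W(ℚ̄_p)[p^∞]))` (h4's currency, `ℚ_[p]`). Map: `ι_J = H¹(W[p^J] ↪ W[p^∞])`
(= `torsionPowToPrimaryH1 W p J`; injective since `W(ℚ̄)[p^∞]^{Γ_{ℚ_{v₀}}} = 0`, §1; onto the `p^J`-torsion; Kummer ↔
`selmerLocalKerPrimary` at `v ≠ v₀`, `∞`; `⊥ ↔ selmerLocalKerPrimaryTorsion` at `v₀` because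
`H¹(ℚ_{v₀}, W[p^J]) → H¹(ℚ_{v₀}, W[p^∞])` is injective when `W(ℚ_{v₀})[p] = 0`; `ℚ_{v₀} ↔ ℚ_[p]` by §3).
[cite: GreenbergLNM1716, §2 pp. 62–63] [cite: MilneADT2006, I §6 Lemma 6.15] -/
theorem HTC4_natCard_selmerGroup_kummerStrict_eq (W : WeierstrassCurve ℚ) [W.IsElliptic] (p : ℕ) [Fact p.Prime]
    (v₀ : HeightOneSpectrum (𝓞 ℚ)) (hv₀ : ((p : ℕ) : 𝓞 ℚ) ∈ v₀.asIdeal)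
    (h0 : ∀ P : (W.baseChange (v₀.adicCompletion ℚ)).toAffine.Point, p • P = 0 → P = 0) (J : ℕ) :
    Nat.card (SelmerStructure.selmerGroup (ρ := W.torsionGaloisModule ((p ^ J : ℕ) : ℤ))
        (KummerPT.kummerStrict W (p ^ J) {(Sum.inr v₀ : Place ℚ)})) =
      Nat.card ((↥(W.selmerGroupPInfty p ⊓ selmerLocalKerPrimaryTorsion W ℚ_[p] p))[((p ^ J : ℕ) : ℤ)]) := by
  obtain rfl : v₀ = primePlace p := eq_primePlace_of_natCast_mem p hv₀
  -- no `Γ_{ℚ_{v₀}}`-fixed point in `W[p^∞]` (h0), hence no `Γ_ℚ`-fixed point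
  have hΓv := geomPrimaryTorsion_eq_zero_of_fixed_adicCompletion W p (primePlace p) h0
  have hΓ : ∀ Q : W.geomPrimaryTorsion p, (∀ σ : absoluteGaloisGroup ℚ, σ • Q = Q) → Q = 0 :=
    fun Q hQ ↦ hΓv Q fun τ ↦ by rw [GaloisRep.restrictField_apply]; exact hQ _
  refine natCard_eq_natCard_torsionBy_of_iff W p J _ _ (W.torsionPowToPrimaryH1_injective p J hΓ) fun c ↦ ?_
  rw [SelmerStructure.mem_selmerGroup_iff, AddSubgroup.mem_inf]
  constructor
  · intro hc
    -- the Kummer condition holds everywhere (`⊥ ≤ 𝓚_{v₀}` at `v₀`)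
    have hkum : ∀ v : Place ℚ, galoisCohomology.localization (W.torsionGaloisModule ((p ^ J : ℕ) : ℤ)) v 1 c ∈
        W.kummerSelmerStructure ((p ^ J : ℕ) : ℤ) v := fun v ↦ by
      have h := hc v
      by_cases hv : v ∈ ({(Sum.inr (primePlace p) : Place ℚ)} : Finset (Place ℚ))
      · rw [KummerPT.kummerStrict_of_mem W (p ^ J) _ hv, AddSubgroup.mem_bot] at h
        rw [h]
        exact zero_mem _
      · rwa [KummerPT.kummerStrict_of_not_mem W (p ^ J) _ hv] at h
    have h0v : galoisCohomology.localization (W.torsionGaloisModule ((p ^ J : ℕ) : ℤ)) (Sum.inr (primePlace p)) 1 c = 0 := by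
      have h := hc (Sum.inr (primePlace p))
      rwa [KummerPT.kummerStrict_of_mem W (p ^ J) _ (Finset.mem_singleton_self _), AddSubgroup.mem_bot] at h
    refine ⟨?_, ?_⟩
    · simp only [WeierstrassCurve.selmerGroupPInfty, AddSubgroup.mem_inf, AddSubgroup.mem_iInf]
      exact ⟨fun v ↦ (localization_inr_mem_kummerSelmerStructure_iff W p J v c).1 (hkum _),
        fun w ↦ (localization_inl_mem_kummerSelmerStructure_iff W p J w c).1 (hkum _)⟩
    · rw [torsionPowToPrimaryH1_mem_selmerLocalKerPrimaryTorsion_padic_iff, h0v]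
      exact map_zero _
  · rintro ⟨hsel, hstr⟩ v
    simp only [WeierstrassCurve.selmerGroupPInfty, AddSubgroup.mem_inf, AddSubgroup.mem_iInf] at hsel
    by_cases hv : v ∈ ({(Sum.inr (primePlace p) : Place ℚ)} : Finset (Place ℚ))
    · rw [KummerPT.kummerStrict_of_mem W (p ^ J) _ hv, AddSubgroup.mem_bot]
      rw [Finset.mem_singleton] at hv
      subst hv
      rw [torsionPowToPrimaryH1_mem_selmerLocalKerPrimaryTorsion_padic_iff] at hstr
      exact map_primaryInclusion_restrictField_injective W p J ((primePlace p).adicCompletion ℚ) hΓv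
        (hstr.trans (map_zero _).symm)
    · rw [KummerPT.kummerStrict_of_not_mem W (p ^ J) _ hv]
      rcases v with w | v
      · exact (localization_inl_mem_kummerSelmerStructure_iff W p J w c).2 (hsel.2 w)
      · exact (localization_inr_mem_kummerSelmerStructure_iff W p J v c).2 (hsel.1 v)

/-! ## §5 ★ HT-C4 (b): the Kummer structure made RELAXED at `v₀` -/

/-- **HT-C4(b) = h6, part (b) (LEVEL PASSAGE, RELAXED at `p`) — hand of LEAD ss-1 GEN 21, signature verbatim.** Same
setting, with only `W(ℚ)[p] = 0` (`hK`): the level-`ℚ` Selmer group of `W[p^J]` for the Kummer structure made RELAXED (`⊤`)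
at `v₀` (`KummerPT.kummerRelaxed`; = `kummerOutside W (p^J) {v₀}`) has exactly as many elements as the `p^J`-torsion of
the RELAXED-at-`p` `p^∞`-Selmer group `{y ∈ H¹(ℚ, W[p^∞]) : y dies in H¹(ℚ_v, W) for every finite v ≠ v₀ and every
infinite w}` (`ι_J` injective from `W(ℚ)[p] = 0`, onto the `p^J`-torsion, Kummer ↔ `selmerLocalKerPrimary` place by place).
[cite: GreenbergLNM1716, §2 pp. 62–63] [cite: MilneADT2006, I §6 (6.5), Lemma 6.15] -/
theorem HTC4_natCard_selmerGroup_kummerRelaxed_eq (W : WeierstrassCurve ℚ) [W.IsElliptic] (p : ℕ) [Fact p.Prime]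
    (v₀ : HeightOneSpectrum (𝓞 ℚ)) (hK : ∀ P : W.toAffine.Point, p • P = 0 → P = 0) (J : ℕ) :
    Nat.card (SelmerStructure.selmerGroup (ρ := W.torsionGaloisModule ((p ^ J : ℕ) : ℤ))
        (KummerPT.kummerRelaxed W (p ^ J) {(Sum.inr v₀ : Place ℚ)})) =
      Nat.card ((↥((⨅ v ∈ {v : HeightOneSpectrum (𝓞 ℚ) | v ≠ v₀}, selmerLocalKerPrimary W (v.adicCompletion ℚ) p) ⊓
        ⨅ w : InfinitePlace ℚ, selmerLocalKerPrimary W w.Completion p))[((p ^ J : ℕ) : ℤ)]) := by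
  -- `W(ℚ)[p] = 0 ⟹ ι_J injective` (§1's generic lemma is elaborated with the classical `DecidableEq` on `ℚ`-points,
  -- the hand's `hK` with `instDecidableEqRat`; `convert` bridges the subsingleton instance gap)
  have hinj : Function.Injective (W.torsionPowToPrimaryH1 p J) :=
    torsionPowToPrimaryH1_injective_of_forall W p J fun P hP ↦ hK P (by convert hP)
  refine natCard_eq_natCard_torsionBy_of_iff W p J _ _ hinj fun c ↦ ?_
  rw [SelmerStructure.mem_selmerGroup_iff, AddSubgroup.mem_inf, AddSubgroup.mem_iInf, AddSubgroup.mem_iInf]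
  constructor
  · intro hc
    have hkum : ∀ v : Place ℚ, v ≠ Sum.inr v₀ →
        galoisCohomology.localization (W.torsionGaloisModule ((p ^ J : ℕ) : ℤ)) v 1 c ∈
          W.kummerSelmerStructure ((p ^ J : ℕ) : ℤ) v := fun v hv ↦ by
      have h := hc v
      rwa [KummerPT.kummerRelaxed_of_not_mem W (p ^ J) _ (by rwa [Finset.mem_singleton])] at h
    refine ⟨fun v ↦ ?_, fun w ↦ (localization_inl_mem_kummerSelmerStructure_iff W p J w c).1
      (hkum _ (by simp))⟩
    rw [AddSubgroup.mem_iInf]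
    intro hv
    exact (localization_inr_mem_kummerSelmerStructure_iff W p J v c).1
      (hkum _ fun h ↦ hv (Sum.inr_injective h))
  · rintro ⟨hfin, hinf⟩ v
    by_cases hv : v ∈ ({(Sum.inr v₀ : Place ℚ)} : Finset (Place ℚ))
    · rw [KummerPT.kummerRelaxed_of_mem W (p ^ J) _ hv]
      exact AddSubgroup.mem_top _
    · rw [KummerPT.kummerRelaxed_of_not_mem W (p ^ J) _ hv]
      rcases v with w | v
      · exact (localization_inl_mem_kummerSelmerStructure_iff W p J w c).2 (hinf w)
      · have hne : v ≠ v₀ := fun h ↦ hv (by rw [Finset.mem_singleton, h])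
        exact (localization_inr_mem_kummerSelmerStructure_iff W p J v c).2
          ((AddSubgroup.mem_iInf.1 (hfin v)) hne)

end Hands

end Summit.BirchSwinnertonDyer.BirchSwinnertonDyer.Theorems.FlatBlindLevelPassage

end
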